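import Summits.Ventures.CertifiedManyBodySolver.Downfold.EmeryShapeTrueCornerRule
import Summits.Ventures.CertifiedManyBodySolver.Downfold.EmeryShapeWindowClosureBand
import HarnessLib

/-!
# THE TRUE-CORNER RULE OVER A FILLING BAND: slab windows and margins certified at the two END fillings squeeze the fixed-doping `t′/t` of every
# member of a typed three-band box between its TRUE-corner values at EVERY filling in between (INFL-3to1-B §B.87 (j))

Venture CertifiedManyBodySolver, cell `pub/hubbard-downfold` (stage S1; INFLATION-RULES-3to1-B §B.87 (j)), seat hubbard-downfold-mod-4 (technique B = band level,
g35); namespace `Summit.Ventures.CertifiedManyBodySolver.Downfold.Emery`. Everything PROVED (0 sorry, no definition). WHAT THIS IS NOT: a statement about any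
material; `U = 0` one-body kinematics of the σ (d–p_x–p_y + t_pp, t_pp′) model (rigid band); no number lives here.

`EmeryShapeTrueCornerRule` bounds object E over the box at ONE filling `ν` from slab windows `[pL, qL] ∋ ε_F` (lower slab), `[pU, qU]` (upper slab) and the
regime energy `qT`. Every Fermi energy entering those hypotheses is NON-DECREASING in the filling (`fermiEnergyOf_mono_filling'`,
`EmeryShapeWindowClosureBand`), so for `ν ∈ [ν₁, ν₂]` it suffices to certify the LOWER window ends at `ν₁` and the UPPER ends (and `qT`) at `ν₂`:

* `fermiEnergyOf_mem_Icc_of_band` — `ε_F(θ; ν) ∈ [e₁, e₂]` from `e₁ ≤ ε_F(θ; ν₁)` and `ε_F(θ; ν₂) ≤ e₂` (the read-out window at a true corner over the band).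
* **`fsRatio_fermiEnergyOf_trueCorner_lower_band`** / **`…_upper_band`** — the true-corner squeeze `R(Δ₁, a₁, b₂, c₂; ν) ≤ R(θ; ν) ≤ R(Δ₂, a₂, b₁, c₁; ν)` for
  every member and EVERY `ν ∈ [ν₁, ν₂]`, with exactly the hypotheses of the one-filling rule except that `pL ≤ ε_F(Δ₁, a₁, b₁, c₂; ν₁)`,
  `ε_F(Δ₁, a₁, b₂, c₁; ν₂) ≤ qL`, `ε_F(Δ₁, a₂, b₂, c₁; ν₂) ≤ qT`, `pU ≤ ε_F(Δ₂, a₂, b₁, c₂; ν₁)`, `ε_F(Δ₂, a₂, b₂, c₁; ν₂) ≤ qU` — the SAME point brackets the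
  per-filling instances use at the two end fillings, now read as ONE statement over the box's whole hole-count row (router/EMERY-SHAPE-CORNERS.tsv «true band» rows).

Sources: three-band model [HybertsenSchluterChristensen1989, Eq. (1)]; contour form [AndersenEtAl1995, §6]; arithmetic [folklore].
-/

noncomputable section

namespace Summit.Ventures.CertifiedManyBodySolver.Downfold.Emery

open Real Set

/-- Over a filling band the Fermi energy of a fixed row stays in the window spanned by its end-filling brackets (`Δ > 0`, `t_pd ≠ 0`, `0 < ν₁ ≤ ν ≤ ν₂ < 1`). [folklore] -/
theorem fermiEnergyOf_mem_Icc_of_band {Δ a b c ν ν₁ ν₂ e₁ e₂ : ℝ} (hΔ : 0 < Δ) (ha : a ≠ 0) (hc : 0 ≤ c) (hb : 0 ≤ b) (hν₁0 : 0 < ν₁)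
    (hν : ν ∈ Icc ν₁ ν₂) (hν₂1 : ν₂ < 1) (h1 : e₁ ≤ fermiEnergyOf Δ a b c ν₁) (h2 : fermiEnergyOf Δ a b c ν₂ ≤ e₂) :
    fermiEnergyOf Δ a b c ν ∈ Icc e₁ e₂ := by
  obtain ⟨hν1, hν2⟩ := hν
  have hν0 : 0 < ν := lt_of_lt_of_le hν₁0 hν1
  have hν1' : ν < 1 := lt_of_le_of_lt hν2 hν₂1
  exact ⟨h1.trans (fermiEnergyOf_mono_filling' hΔ ha hc hb hν₁0 hν1 hν1'),
    (fermiEnergyOf_mono_filling' hΔ ha hc hb hν0 hν2 hν₂1).trans h2⟩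

/-- **THE TRUE-CORNER LOWER BOUND OVER A FILLING BAND**: the lower-slab window certified at the end fillings (`pL` at `ν₁`, `qL` at `ν₂`) gives
`R(Δ₁, a₁, b₂, c₂; ν) ≤ R(θ; ν)` for every member and every `ν ∈ [ν₁, ν₂]`. [folklore] -/
theorem fsRatio_fermiEnergyOf_trueCorner_lower_band {Δ a b c Δ₁ a₁ b₁ b₂ c₁ c₂ ν ν₁ ν₂ pL qL Mb Mc : ℝ} (hΔ₁ : 0 < Δ₁) (hΔ : Δ₁ ≤ Δ)
    (ha₁ : 0 < a₁) (ha : a₁ ≤ a) (hb₁ : 0 < b₁) (hb : b ∈ Icc b₁ b₂) (hc₁ : 0 ≤ c₁) (hc : c ∈ Icc c₁ c₂) (hc₂b : c₂ ≤ b₁)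
    (hν₁0 : 0 < ν₁) (hν : ν ∈ Icc ν₁ ν₂) (hν₂1 : ν₂ < 1)
    (hp0 : 0 ≤ pL) (hpL : pL ≤ fermiEnergyOf Δ₁ a₁ b₁ c₂ ν₁) (hqL : fermiEnergyOf Δ₁ a₁ b₂ c₁ ν₂ ≤ qL) (hcapw : c₂ * (Δ₁ + 2 * qL) ≤ a₁ ^ 2)
    (hTmin : 0 ≤ fsD Δ₁ a₁ c₂ pL + 2 * fsN a₁ b₂ c₁ pL)
    (hMb0 : 0 ≤ Mb) (hMb : -Mb ≤ a₁ ^ 2 * ((b₂ ^ 2 - c₂ ^ 2) * Δ₁ - 2 * (c₂ + b₂) * (a₁ ^ 2 - c₁ * Δ₁) + 4 * c₁ * (c₁ + b₂) * pL) + c₁ * (b₂ ^ 2 - c₂ ^ 2) * pL ^ 2)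
    (hmb : 4 * Mb * (fsD Δ₁ a₁ c₁ qL + 2 * fsN a₁ b₂ c₂ qL) ^ 2 ≤
      2 * a₁ ^ 2 * ((Δ₁ + pL) * (a₁ ^ 2 - c₂ * qL)) * (fsD Δ₁ a₁ c₂ pL + 2 * fsN a₁ b₂ c₁ pL) ^ 2)
    (hMc0 : 0 ≤ Mc) (hMc : dopingDisc Δ₁ a₁ b₂ c₂ qL qL ≤ Mc)
    (hmc : 4 * Mc * ((fsD Δ₁ a₁ c₁ qL + 2 * fsN a₁ b₂ c₂ qL) * (fsD Δ₁ a₁ c₂ qL + 2 * fsN a₁ b₂ c₂ qL)) ≤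
      (((Δ₁ + pL) * (a₁ ^ 2 - c₂ * qL)) * (2 * a₁ ^ 2 - 2 * c₂ * qL) + fsN a₁ b₂ c₁ pL * ((Δ₁ + pL) * pL)) * (fsD Δ₁ a₁ c₂ pL + 2 * fsN a₁ b₂ c₂ pL) ^ 2) :
    fsRatio Δ₁ a₁ b₂ c₂ (fermiEnergyOf Δ₁ a₁ b₂ c₂ ν) ≤ fsRatio Δ a b c (fermiEnergyOf Δ a b c ν) := by
  obtain ⟨hν1, hν2⟩ := hν
  have hν0 : 0 < ν := lt_of_lt_of_le hν₁0 hν1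
  have hν1' : ν < 1 := lt_of_le_of_lt hν2 hν₂1
  have hb₂ : 0 < b₂ := lt_of_lt_of_le hb₁ (hb.1.trans hb.2)
  have hc₂ : 0 ≤ c₂ := hc₁.trans (hc.1.trans hc.2)
  have hSL : fermiEnergyOf Δ₁ a₁ b₁ c₂ ν₁ ≤ fermiEnergyOf Δ₁ a₁ b₁ c₂ ν :=
    fermiEnergyOf_mono_filling' hΔ₁ ha₁.ne' hc₂ hb₁.le hν₁0 hν1 hν1'
  have hAL : fermiEnergyOf Δ₁ a₁ b₂ c₁ ν ≤ fermiEnergyOf Δ₁ a₁ b₂ c₁ ν₂ :=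
    fermiEnergyOf_mono_filling' hΔ₁ ha₁.ne' hc₁ hb₂.le hν0 hν2 hν₂1
  exact fsRatio_fermiEnergyOf_trueCorner_lower hΔ₁ hΔ ha₁ ha hb₁ hb hc₁ hc hc₂b hν0 hν1' hp0 (hpL.trans hSL) (hAL.trans hqL) hcapw
    hTmin hMb0 hMb hmb hMc0 hMc hmc

/-- **THE TRUE-CORNER UPPER BOUND OVER A FILLING BAND**: the upper-slab window (`pU` at `ν₁`, `qU` at `ν₂`) and the regime energy `qT` at `ν₂` give
`R(θ; ν) ≤ R(Δ₂, a₂, b₁, c₁; ν)` for every member and every `ν ∈ [ν₁, ν₂]`. [folklore] -/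
theorem fsRatio_fermiEnergyOf_trueCorner_upper_band {Δ a b c Δ₁ Δ₂ a₁ a₂ b₁ b₂ c₁ c₂ ν ν₁ ν₂ pU qU qT Mb Mc : ℝ} (hΔ₁ : 0 < Δ₁)
    (hΔ : Δ ∈ Icc Δ₁ Δ₂) (ha₁ : 0 < a₁) (ha : a ∈ Icc a₁ a₂) (hb₁ : 0 < b₁) (hb : b ∈ Icc b₁ b₂) (hc₁ : 0 ≤ c₁) (hc : c ∈ Icc c₁ c₂)
    (hc₂b : c₂ ≤ b₁) (hν₁0 : 0 < ν₁) (hν : ν ∈ Icc ν₁ ν₂) (hν₂1 : ν₂ < 1)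
    (hqT : fermiEnergyOf Δ₁ a₂ b₂ c₁ ν₂ ≤ qT) (hregT : c₂ * qT ≤ a₁ ^ 2)
    (hp0 : 0 ≤ pU) (hpU : pU ≤ fermiEnergyOf Δ₂ a₂ b₁ c₂ ν₁) (hqU : fermiEnergyOf Δ₂ a₂ b₂ c₁ ν₂ ≤ qU) (hcapw : c₂ * (Δ₂ + 2 * qU) ≤ a₂ ^ 2)
    (hTmin : 0 ≤ fsD Δ₂ a₂ c₂ pU + 2 * fsN a₂ b₁ c₁ pU)
    (hMb0 : 0 ≤ Mb) (hMb : -Mb ≤ a₂ ^ 2 * ((b₁ ^ 2 - c₂ ^ 2) * Δ₂ - 2 * (c₂ + b₂) * (a₂ ^ 2 - c₁ * Δ₂) + 4 * c₁ * (c₁ + b₁) * pU) + c₁ * (b₁ ^ 2 - c₂ ^ 2) * pU ^ 2)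
    (hmb : 4 * Mb * (fsD Δ₂ a₂ c₁ qU + 2 * fsN a₂ b₂ c₂ qU) ^ 2 ≤
      2 * a₂ ^ 2 * ((Δ₂ + pU) * (a₂ ^ 2 - c₂ * qU)) * (fsD Δ₂ a₂ c₂ pU + 2 * fsN a₂ b₁ c₁ pU) ^ 2)
    (hMc0 : 0 ≤ Mc) (hMc : a₂ ^ 2 * (b₁ ^ 2 * Δ₂ - 2 * (c₁ + b₁) * (a₂ ^ 2 - c₂ * Δ₂) + 4 * c₂ * (c₂ + b₁) * qU) + c₂ * b₁ ^ 2 * qU ^ 2 ≤ Mc)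
    (hmc : 4 * Mc * ((fsD Δ₂ a₂ c₁ qU + 2 * fsN a₂ b₁ c₁ qU) * (fsD Δ₂ a₂ c₁ qU + 2 * fsN a₂ b₁ c₂ qU)) ≤
      (((Δ₂ + pU) * (a₂ ^ 2 - c₁ * qU)) * (2 * a₂ ^ 2 - 2 * c₂ * qU) + fsN a₂ b₁ c₁ pU * ((Δ₂ + pU) * pU)) * (fsD Δ₂ a₂ c₂ pU + 2 * fsN a₂ b₁ c₁ pU) ^ 2) :
    fsRatio Δ a b c (fermiEnergyOf Δ a b c ν) ≤ fsRatio Δ₂ a₂ b₁ c₁ (fermiEnergyOf Δ₂ a₂ b₁ c₁ ν) := by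
  obtain ⟨hν1, hν2⟩ := hν
  have hν0 : 0 < ν := lt_of_lt_of_le hν₁0 hν1
  have hν1' : ν < 1 := lt_of_le_of_lt hν2 hν₂1
  have hΔ₂ : 0 < Δ₂ := lt_of_lt_of_le hΔ₁ (hΔ.1.trans hΔ.2)
  have ha₂ : 0 < a₂ := lt_of_lt_of_le ha₁ (ha.1.trans ha.2)
  have hb₂ : 0 < b₂ := lt_of_lt_of_le hb₁ (hb.1.trans hb.2)
  have hc₂ : 0 ≤ c₂ := hc₁.trans (hc.1.trans hc.2)
  have hH : fermiEnergyOf Δ₁ a₂ b₂ c₁ ν ≤ fermiEnergyOf Δ₁ a₂ b₂ c₁ ν₂ :=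
    fermiEnergyOf_mono_filling' hΔ₁ ha₂.ne' hc₁ hb₂.le hν0 hν2 hν₂1
  have hSU : fermiEnergyOf Δ₂ a₂ b₁ c₂ ν₁ ≤ fermiEnergyOf Δ₂ a₂ b₁ c₂ ν :=
    fermiEnergyOf_mono_filling' hΔ₂ ha₂.ne' hc₂ hb₁.le hν₁0 hν1 hν1'
  have hQU : fermiEnergyOf Δ₂ a₂ b₂ c₁ ν ≤ fermiEnergyOf Δ₂ a₂ b₂ c₁ ν₂ :=
    fermiEnergyOf_mono_filling' hΔ₂ ha₂.ne' hc₁ hb₂.le hν0 hν2 hν₂1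
  exact fsRatio_fermiEnergyOf_trueCorner_upper hΔ₁ hΔ ha₁ ha hb₁ hb hc₁ hc hc₂b hν0 hν1' (hH.trans hqT) hregT hp0 (hpU.trans hSU)
    (hQU.trans hqU) hcapw hTmin hMb0 hMb hmb hMc0 hMc hmc

end Summit.Ventures.CertifiedManyBodySolver.Downfold.Emery
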